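import Summits.HodgeConjecture.HodgeConjecture.Theses.PeriodsPolice
import HarnessLib

/-!
# Route PeriodsPolice — support item `TorsorGPCImpliesPolicing` (stmt-HodgeConjecture-14611), PROVED

Card Lemma 1a of the route (Bost–Charles 2016 §2.1.2 / André 2004 §7.5, §23.1 / Deligne 1982 §1):
for a period realization `P` over `ℚ̄`, `σ : ℚ̄ →+* ℂ` and a smooth projective `X₀/ℚ̄` of dimension
`n` — IF the FILTERED complex points of the torsor of motivated periods `Ω^And_{X₀}` (the points
`f₀ ∈ Ω^And_{X₀}(ℂ)` carrying `Fᵖ Hⁱ_dR(X₀^m) ⊗_{ℚ̄,σ} ℂ` onto the Hodge filtration of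
`Hⁱ_B((X₀^m)_σ) ⊗ ℂ`) are `ℚ̄`-Zariski dense in `Ω^And_{X₀}`, THEN every motivated automorphism family
`g = (g_{m,i})` of the Betti cohomology of the powers of `X₀` preserves the Hodge classes
`Hdgᵖ((X₀^m)_σ)`. The theorem `periodsPolice_torsorGPCImpliesPolicing_proof` has literally the type of
the route decl `Summit.HodgeConjecture.HodgeConjecture.Theses.PeriodsPolice.TorsorGPCImpliesPolicing`.

Proof. Fix a Hodge class `x` (`1 ⊗ x ∈ Fᵖ`), write `c` for the comparison point (filtered, by the
axiom `iso_fil` of `PeriodRealization`) and `F = Fᵖ H²ᵖ_dR(X₀^m)`.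
1. The inverse family `g⁻¹` is again motivated (`periodsPolice_isMotivatedAutFamily_symm`), so
   `f₂ := g⁻¹ · c` is a `ℂ`-point of the torsor (`MotivatedPeriodTorsor.act`), with
   `f₂⁻¹(1 ⊗ x) = c⁻¹(1 ⊗ g x)`.
2. For every `ψ` in the annihilator of `F`, the coordinate `X_{(m,2p,x,ψ)}` — the polynomial
   `f ↦ ψ_R(f⁻¹(1 ⊗ x))` — vanishes at every FILTERED point `f₀`: filteredness and `1 ⊗ x ∈ Fᵖ_B` put
   `f₀⁻¹(1 ⊗ x)` in `ℂ ⊗ F`, where `ψ_ℂ` vanishes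
   (`periodsPolice_dual_baseChange_eq_zero_of_mem_baseChange`). By the density hypothesis it vanishes
   at `f₂`: `ψ_ℂ(c⁻¹(1 ⊗ g x)) = 0` for all `ψ ∈ F^⊥`.
3. LINEAR ALGEBRA (`periodsPolice_mem_baseChange_of_forall_dual`): over a field, a vector of `R ⊗ D`
   killed by the base changes of all functionals vanishing on the subspace `F` lies in `R ⊗ F` (right
   exactness of `R ⊗ (F ↪ D ↠ D/F)`, `lTensor_exact`, and coordinates in a basis of `R ⊗ (D/F)`,
   `Algebra.TensorProduct.basis`). Hence `c⁻¹(1 ⊗ g x) ∈ ℂ ⊗ F`.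
4. Applying `c` and `iso_fil`: `1 ⊗ g x ∈ c(ℂ ⊗ F) = Fᵖ_B`, i.e. `g x` is a Hodge class.

No definition, no named-fact hypothesis (the open hypothesis `GPC` is consumed, never asserted), no sorry.

References: [BostCharles2014] §2.1.2, Def. 2.4, Def. 2.9, Cor. 2.11; [Andre2004] §7.5, §23.1;
[Deligne1982HodgeCycles] §1 and Prop. 3.1; [HuberMullerStachPeriodsIII2015] Def. 12.2.3.
-/

noncomputable section

-- every declaration of this problem lives in `Summit.HodgeConjecture.HodgeConjecture.…` (summit = sub-problem)
set_option linter.dupNamespace false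

namespace Summit.HodgeConjecture.HodgeConjecture.Theorems

open TensorProduct
open Literature.AlgebraicGeometry.Motives
open Summit.HodgeConjecture.HodgeConjecture.Theses.PeriodsPolice (TorsorGPCImpliesPolicing)

/-! ### Linear algebra: the base change of a subspace is cut out by its annihilator -/

section LinearAlgebra

variable {K : Type*} [Field K] {R : Type*} [CommRing R] [Algebra K R]
  {D : Type*} [AddCommGroup D] [Module K D]

/-- **Easy direction.** A functional `ψ` vanishing on the subspace `F ⊆ D` has base change `ψ_R`
vanishing on `R ⊗ F ⊆ R ⊗ D`. [folklore] -/
theorem periodsPolice_dual_baseChange_eq_zero_of_mem_baseChange (F : Submodule K D)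
    {ψ : Module.Dual K D} (hψ : ψ ∈ F.dualAnnihilator) {y : R ⊗[K] D}
    (hy : y ∈ F.baseChange R) : Module.Dual.baseChange R ψ y = 0 := by
  obtain ⟨u, rfl⟩ := hy
  induction u using TensorProduct.induction_on with
  | zero => rw [map_zero, map_zero]
  | add u v hu hv => rw [map_add, map_add, hu, hv, add_zero]
  | tmul r f =>
    rw [LinearMap.baseChange_tmul, Module.Dual.baseChange_apply_tmul, Submodule.subtype_apply,
      (Submodule.mem_dualAnnihilator ψ).1 hψ _ f.2, zero_smul]

/-- **A vector of `R ⊗_K Q` killed by the base changes of all functionals of `Q` is zero** (`K` a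
field: read the coordinates in the `R`-basis `1 ⊗ bᵢ` of `R ⊗ Q`, `Algebra.TensorProduct.basis`; the
`i`-th coordinate is the base change of the coordinate functional `bᵢ^*`). [folklore] -/
theorem periodsPolice_eq_zero_of_forall_dual_baseChange {Q : Type*} [AddCommGroup Q] [Module K Q]
    {z : R ⊗[K] Q} (hz : ∀ χ : Module.Dual K Q, Module.Dual.baseChange R χ z = 0) : z = 0 := by
  let b := Module.Free.chooseBasis K Q
  let B := Algebra.TensorProduct.basis R b
  have key : ∀ (i) (w : R ⊗[K] Q), B.repr w i = Module.Dual.baseChange R (b.coord i) w := by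
    intro i w
    induction w using TensorProduct.induction_on with
    | zero => rw [map_zero, map_zero, Finsupp.zero_apply]
    | add u v hu hv => rw [map_add, map_add, Finsupp.add_apply, hu, hv]
    | tmul r q =>
      rw [Algebra.TensorProduct.basis_repr_tmul, Module.Dual.baseChange_apply_tmul,
        Finsupp.smul_apply, Finsupp.mapRange_apply]
      change r • algebraMap K R (b.repr q i) = (b.repr q i) • r
      rw [smul_eq_mul, Algebra.smul_def, mul_comm]
  refine B.ext_elem fun i ↦ ?_
  rw [key, hz, map_zero, Finsupp.zero_apply]

/-- Naturality of `Module.Dual.baseChange` in the functional: `(χ ∘ h)_R = χ_R ∘ h_R`. [folklore] -/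
theorem periodsPolice_dual_baseChange_comp {Q : Type*} [AddCommGroup Q] [Module K Q]
    (χ : Module.Dual K Q) (h : D →ₗ[K] Q) (w : R ⊗[K] D) :
    Module.Dual.baseChange R (χ ∘ₗ h) w = Module.Dual.baseChange R χ (h.lTensor R w) := by
  induction w using TensorProduct.induction_on with
  | zero => rw [map_zero, map_zero, map_zero]
  | add u v hu hv => rw [map_add, map_add, map_add, hu, hv]
  | tmul r d =>
    rw [LinearMap.lTensor_tmul, Module.Dual.baseChange_apply_tmul, Module.Dual.baseChange_apply_tmul,
      LinearMap.comp_apply]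

/-- **Hard direction: `R ⊗ F` is cut out of `R ⊗ D` by the annihilator of `F`** (`K` a field). If
`ψ_R(y) = 0` for every functional `ψ` of `D` vanishing on `F`, then `y ∈ R ⊗ F`: by right exactness of
`R ⊗_K (0 → F → D → D/F → 0)` (`lTensor_exact`) it suffices that the image of `y` in `R ⊗ (D/F)`
vanish, and that image is killed by the base change of every functional `χ` of `D/F`
(`χ ∘ (D ↠ D/F)` annihilates `F`), hence is zero (`periodsPolice_eq_zero_of_forall_dual_baseChange`).
[folklore] -/
theorem periodsPolice_mem_baseChange_of_forall_dual (F : Submodule K D) {y : R ⊗[K] D}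
    (hy : ∀ ψ ∈ F.dualAnnihilator, Module.Dual.baseChange R ψ y = 0) :
    y ∈ F.baseChange R := by
  have hex : Function.Exact (F.subtype.lTensor R) (F.mkQ.lTensor R) :=
    lTensor_exact R (LinearMap.exact_subtype_mkQ F) (Submodule.mkQ_surjective F)
  have h0 : F.mkQ.lTensor R y = 0 := by
    refine periodsPolice_eq_zero_of_forall_dual_baseChange (K := K) fun χ ↦ ?_
    rw [← periodsPolice_dual_baseChange_comp]
    refine hy _ ((Submodule.mem_dualAnnihilator _).2 fun w hw ↦ ?_)
    rw [LinearMap.comp_apply, Submodule.mkQ_apply, (Submodule.Quotient.mk_eq_zero F).2 hw, map_zero]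
  obtain ⟨u, hu⟩ := (hex y).1 h0
  exact ⟨u, hu⟩

end LinearAlgebra

/-! ### The inverse of a motivated automorphism family is motivated -/

section Torsor

variable {k : Type} [Field k] [CharZero k] {P : PeriodRealization k} {σ : k →+* ℂ} {n : ℕ}
  {X₀ : SchemeOver k}
  {g : ∀ m i : ℕ, (P.B.comap σ).obj (X₀.pow m) i ≃ₗ[ℚ] (P.B.comap σ).obj (X₀.pow m) i}

/-- **The inverse family `(g_{m,i}⁻¹)` of a motivated automorphism family is motivated** (natural,
unital, multiplicative, fixing the motivated classes — the `ℚ`-points of the kernel of the Tate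
character form a group; André 1996 §4.6). [cite: Andre1996Motifs, §4.6 Définition (ii)] -/
theorem periodsPolice_isMotivatedAutFamily_symm (hg : P.IsMotivatedAutFamily σ n X₀ g) :
    P.IsMotivatedAutFamily σ n X₀ (fun m i ↦ (g m i).symm) where
  pullback m m' φ i y := by
    apply (g m i).injective
    rw [LinearEquiv.apply_symm_apply, hg.pullback, LinearEquiv.apply_symm_apply]
  one m := by
    apply (g m 0).injective
    rw [LinearEquiv.apply_symm_apply, hg.one]
  cup m i j l h x y := by
    apply (g m l).injective
    rw [LinearEquiv.apply_symm_apply, hg.cup, LinearEquiv.apply_symm_apply,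
      LinearEquiv.apply_symm_apply]
  motivated m p β hβ := by
    apply (g m (2 * p)).injective
    rw [LinearEquiv.apply_symm_apply, hg.motivated m p β hβ]

end Torsor

/-! ### The item -/

/-- **Item stmt-HodgeConjecture-14611 (`TorsorGPCImpliesPolicing`, route `PeriodsPolice`), PROVED**
(card Lemma 1a; Bost–Charles 2016 §2.1.2, André 2004 §23.1): if the filtered complex points of the
torsor of motivated periods of `X₀/ℚ̄` are `ℚ̄`-Zariski dense in it, every motivated automorphism
family of the Betti cohomology of the powers of `X₀` preserves the Hodge classes. For a Hodge class
`x` and `ψ` annihilating `Fᵖ H_dR`, the coordinate polynomial `f ↦ ψ(f⁻¹(1 ⊗ x))` vanishes at the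
filtered points, hence (density) at the point `g⁻¹ · c` (`c` the comparison, `g⁻¹` motivated by
`periodsPolice_isMotivatedAutFamily_symm`), i.e. `ψ(c⁻¹(1 ⊗ g x)) = 0`; so `c⁻¹(1 ⊗ g x) ∈ ℂ ⊗ Fᵖ H_dR`
(`periodsPolice_mem_baseChange_of_forall_dual`) and `1 ⊗ g x ∈ c(ℂ ⊗ Fᵖ H_dR) = Fᵖ H_B` (`iso_fil`).
The type is literally the route decl
`Summit.HodgeConjecture.HodgeConjecture.Theses.PeriodsPolice.TorsorGPCImpliesPolicing`.
[cite: BostCharles2014, §2.1.2, Def. 2.9 and Cor. 2.11] [cite: Andre2004, §7.5 and §23.1]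
[cite: Deligne1982HodgeCycles, §1 and Prop. 3.1] -/
theorem periodsPolice_torsorGPCImpliesPolicing_proof : TorsorGPCImpliesPolicing := by
  intro P σ n X₀ hX hdense g hg m hXm p x hx
  -- the inverse family, the comparison point `c`, and the point `f₂ = g⁻¹ · c`
  have hg' := periodsPolice_isMotivatedAutFamily_symm hg
  let c := P.comparisonPoint σ hX
  let f₂ := c.act hg'
  -- the de Rham Hodge filtration step `F = Fᵖ H²ᵖ_dR(X₀^m)`
  let F : Submodule (AlgebraicClosure ℚ) (P.dR.obj (X₀.pow m) (2 * p)) :=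
    P.dR.fil (X := X₀.pow m) (2 * p) (p : ℤ)
  -- `f₂⁻¹ (1 ⊗ x) = c⁻¹ (1 ⊗ g x)`
  have hy₂ : (f₂.iso m (2 * p)).symm ((1 : AlongHom ℂ σ) ⊗ₜ[ℚ] x) =
      (c.iso m (2 * p)).symm ((1 : AlongHom ℂ σ) ⊗ₜ[ℚ] g m (2 * p) x) := by
    rw [PeriodRealization.MotivatedPeriodTorsor.act_iso_symm_apply]
    congr 1
  -- KEY: `c⁻¹ (1 ⊗ g x) ∈ ℂ ⊗ F`
  have hmem : (c.iso m (2 * p)).symm ((1 : AlongHom ℂ σ) ⊗ₜ[ℚ] g m (2 * p) x) ∈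
      F.baseChange (AlongHom ℂ σ) := by
    refine periodsPolice_mem_baseChange_of_forall_dual F fun ψ hψ ↦ ?_
    -- density, applied to the coordinate polynomial `X_{(m, 2p, x, ψ)}`
    have hΦ := hdense (MvPolynomial.X (PeriodRealization.Coord.isoInv m (2 * p) x ψ)) ?_
      (AlongHom ℂ σ) f₂
    · rw [MvPolynomial.aeval_X, PeriodRealization.MotivatedPeriodTorsor.coord_isoInv, hy₂] at hΦ
      exact hΦ
    · -- every filtered point kills the coordinate
      intro f₀ hf₀
      rw [MvPolynomial.aeval_X, PeriodRealization.MotivatedPeriodTorsor.coord_isoInv]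
      refine periodsPolice_dual_baseChange_eq_zero_of_mem_baseChange F hψ ?_
      -- `1 ⊗ x ∈ Fᵖ_B = f₀ (ℂ ⊗ F)` (filteredness), so `f₀⁻¹ (1 ⊗ x) ∈ ℂ ⊗ F`
      have hx' : HodgeStructure.ofRat x ∈
          (((F.baseChange (AlongHom ℂ σ)).map (f₀.iso m (2 * p)).toLinearMap).restrictScalars ℚ).map
            (alongHomTensorEquiv σ ((P.B.comap σ).obj (X₀.pow m) (2 * p))).toLinearMap := by
        rw [hf₀ m (2 * p) hXm (p : ℤ)]
        exact hx
      obtain ⟨w, hw, hwx⟩ := hx'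
      obtain ⟨u, hu, huw⟩ := hw
      have hw1 : w = (1 : AlongHom ℂ σ) ⊗ₜ[ℚ] x := by
        apply (alongHomTensorEquiv σ ((P.B.comap σ).obj (X₀.pow m) (2 * p))).injective
        rw [LinearEquiv.coe_toLinearMap] at hwx
        rw [hwx]
        exact ((alongHomTensorEquiv_tmul σ (1 : AlongHom ℂ σ) x).trans (by rw [map_one]; rfl)).symm
      have hux : (f₀.iso m (2 * p)).symm ((1 : AlongHom ℂ σ) ⊗ₜ[ℚ] x) = u := by
        rw [LinearEquiv.symm_apply_eq]
        exact hw1.symm.trans huw.symm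
      exact hux ▸ hu
  -- push through `c` and `iso_fil`: `1 ⊗ g x ∈ c (ℂ ⊗ F) = Fᵖ_B`
  have hgx : HodgeStructure.ofRat (g m (2 * p) x) ∈
      ((((P.dR.fil (X := X₀.pow m) (2 * p) (p : ℤ)).baseChange (AlongHom ℂ σ)).map
          (P.iso σ (X₀.pow m) (2 * p))).restrictScalars ℚ).map
        (alongHomTensorEquiv σ ((P.B.comap σ).obj (X₀.pow m) (2 * p))).toLinearMap := by
    refine ⟨(1 : AlongHom ℂ σ) ⊗ₜ[ℚ] g m (2 * p) x, ⟨_, hmem, ?_⟩, ?_⟩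
    · exact (P.isoEquiv σ (hX.pow m) (2 * p)).apply_symm_apply _
    · rw [LinearEquiv.coe_toLinearMap, alongHomTensorEquiv_tmul, map_one, HodgeStructure.ofRat_apply]
  rw [P.iso_fil σ (hX.pow m) hXm (2 * p) (p : ℤ)] at hgx
  exact ((P.B.hodge hXm (2 * p)).mem_hodgeClasses_iff (p : ℤ) (g m (2 * p) x)).2 hgx

end Summit.HodgeConjecture.HodgeConjecture.Theorems

end
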